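import Literature.AlgebraicGeometry.Morphisms.CechH2FibreDimOne
import Literature.AlgebraicGeometry.Morphisms.CechH2FibreDimOneProjective
import Literature.AlgebraicGeometry.Morphisms.CechH1PreimageGluing
import Literature.AlgebraicGeometry.Resolution.ResolutionFibreDimension
import HarnessLib

/-!
# Crux `NoZenoR` (stmt-ResolutionOfSingularities-19943) — DR-F53 (a): the DOOR's TARGET INSTANCE of
# `GortzWedhorn2023_24_44_H2` and its three consumer-shaped re-exports (V35c recipe §R3)

OURS (cell res-hironaka, crux chain W4.4; text of the instance = W4.4 desk res-L0-w44-plan-1 g23, `GWH2Instance.lean`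
3f626f81346a925b, VERBATIM; re-exports and filing = prover res-inputs-p-6, D-0154 (2) inputs phase, critic GO-TO-TYPE REFEREE R17 (4)).
Counted 0; AI-written, weaker than expert review; nothing here is a statement of the manuscript under review (Hironaka 2017).

`GWH2ProperBirationalDim2` is the weakest single INSTANCE of the named fact
`Literature.AlgebraicGeometry.Morphisms.GortzWedhorn2023_24_44_H2` (Görtz–Wedhorn II Cor. 24.44, Čech form; STAYS PRINT) that serves all
four application leaves of the W4.4 line verbatim (desk census `F53-CONSUMER-CENSUS-v0.md` 730248cc39196ee4, leaves L1–L4): base `A` a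
Noetherian local DOMAIN of Krull dimension `≤ 2`; `f : Y → Spec A` PROPER BIRATIONAL with `Y` INTEGRAL; `M` affine-localizing;
`𝒰` a finite affine open cover ⇒ `Ȟ²(𝒰, M) = 0`.  It is a HYPOTHESIS `Prop` (users take `(h : GWH2ProperBirationalDim2)`), never
asserted here; general ⇒ instance is the one line `gwH2ProperBirationalDim2_of_GW` (fibre bound DERIVED by the tree's
`Resolution.topologicalKrullDim_fiber_le_one_of_isBirational`), which is what makes the desk's next facts-slot re-cut weaken-only.
Universe `0` = the universe at which every W4.4 consumer instantiates the fact.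

Re-exports (each ONE line over the FACT-FREE Literature cores, exactly as the general `…_of_GW` forms are):
* `GWH2ProperBirationalDim2.cechMapH1_surjective` — `Ȟ¹` right exact (leaf L1 / L2 shape; core
  `Morphisms.cechMapH1_surjective_of_shortExact`, `CechH2FibreDimOne.lean`);
* `GWH2ProperBirationalDim2.cechZ2_exact_preimageFamily` — (H2V) for preimage pieces (core
  `Morphisms.cechZ2_exact_preimageFamily_of_subsingleton_cechMH2_pushforward`, `CechH1PreimageGluing.lean` §1);
* `GWH2ProperBirationalDim2.cechRefineH1_preimage_piece_surjective`, `….length_cechH1_preimage_piece_le`,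
  `….cechRefineH1_preimage_piece_surjective'` — the (S)-step (leaf L3 shape; core `Morphisms.cechRefineH1_piece_surjective`, §3).
§R3b (APPENDED 2026-08-28, desk re-cut r2 after p613816 `GortzWedhorn2023_24_44_H2_of_projective`, rider R20 (r2-b) taken;
text of `L/res-L0-w44-plan-1/GWH2InstanceR2b.lean` 94c5596e024bd2f4 VERBATIM): `GWH2ResolutionDim2` — the same conclusion for
RESOLUTIONS ONLY of spectra of Noetherian local domains of Krull dimension `= 2` (`IsResolution π`, what leaves L1/L2/L4 consume;
weaken-only chain GW ⇒ `GWH2ProperBirationalDim2` ⇒ `GWH2ResolutionDim2`), its three feeders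
`gwH2ResolutionDim2_of_properBirational` / `_of_GW` / `_of_projectiveResolutions` (the last = p613816 + the fibre bound: conjunct 6
reduces to PROJECTIVITY of resolutions, Lipman 1969 Cor. (27.2), print, untyped), and re-export (i) at resolutions
`GWH2ResolutionDim2.cechMapH1_surjective[_of_isQuasicoherent]` (leaf L1's door).  The r1 declarations above are untouched.
This file discharges NOTHING: `GortzWedhorn2023_24_44_H2` and `GWH2ProperBirationalDim2` are unproved hypotheses; no summit statement is
proved; resolution of singularities in dimension ≥ 4 / characteristic p is NOT proved by anything here.
-/

-- single-problem summit: the doubled namespace component `ResolutionOfSingularities` is forced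
set_option linter.dupNamespace false

open CategoryTheory CategoryTheory.Limits AlgebraicGeometry TopologicalSpace
open Literature.AlgebraicGeometry.Morphisms Literature.AlgebraicGeometry.Resolution
open Literature.AlgebraicGeometry.Modules

namespace Summit.ResolutionOfSingularities.ResolutionOfSingularities.Theorems.NoZeno

/-- **Instance text (DR-F53 (a))**: `Ȟ² = 0` for affine-localizing modules on an integral scheme proper and birational over
a Noetherian local domain of Krull dimension `≤ 2`, on every finite affine open cover.  OURS (instance text of a
printed fact; the fact itself stays PRINT). [this work] -/
def GWH2ProperBirationalDim2 : Prop :=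
  ∀ (A : Type) [CommRing A] [IsNoetherianRing A] [IsLocalRing A] [IsDomain A], ringKrullDim A ≤ 2 →
    ∀ (Y : Scheme.{0}) [IsIntegral Y] (f : Y ⟶ Spec (.of A)) [IsProper f], IsBirational f →
      ∀ (M : Y.Modules), Literature.AlgebraicGeometry.Modules.IsAffineLocalizing M →
        ∀ (ι : Type) [Finite ι] (U : ι → Y.Opens),
          (∀ i, IsAffineOpen (U i)) → ⨆ i, U i = ⊤ → Subsingleton (CechMH2 f M U)

/-- General ⇒ instance (the one line that makes the re-cut weaken-only). [this work] -/
theorem gwH2ProperBirationalDim2_of_GW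
    (h : Literature.AlgebraicGeometry.Morphisms.GortzWedhorn2023_24_44_H2.{0}) :
    GWH2ProperBirationalDim2 := by
  intro A _ _ _ _ hdim Y _ f _ hbir M hM ι _ U hU hcov
  exact h A Y f
    (Literature.AlgebraicGeometry.Resolution.topologicalKrullDim_fiber_le_one_of_isBirational hdim hbir)
    M hM ι U hU hcov

/-! ## Re-export (i): right exactness of `Ȟ¹` (leaves L1, L2) -/

/-- **`Ȟ¹` is right exact on an integral scheme proper birational over a Noetherian local domain of dimension `≤ 2`**
(modulo the instance `GWH2ProperBirationalDim2`): for a short exact sequence `0 → M′ → M → M″ → 0` of `𝒪_X`-modules with `M′`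
affine-localizing and ANY finite affine open cover `𝒰` of `X` (pairwise intersections affine, `X` being separated),
`Ȟ¹(𝒰, M) → Ȟ¹(𝒰, M″)` is surjective.  One line over the fact-free core `cechMapH1_surjective_of_shortExact`; the instance
twin of `GortzWedhorn2023_24_44_H2.cechMapH1_surjective` with `(hA, hbir)` replacing `hfib`. [this work] -/
theorem GWH2ProperBirationalDim2.cechMapH1_surjective (h : GWH2ProperBirationalDim2)
    {A : Type} [CommRing A] {X : Scheme.{0}} (f : X ⟶ Spec (.of A)) {ι : Type} (U : ι → X.Opens)
    [IsNoetherianRing A] [IsLocalRing A] [IsDomain A] (hA : ringKrullDim A ≤ 2) [IsIntegral X] [IsProper f]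
    (hbir : IsBirational f) {S : ShortComplex X.Modules} (hS : S.ShortExact)
    (h₁ : IsAffineLocalizing S.X₁) [Finite ι] (hU : ∀ i, IsAffineOpen (U i)) (hcov : ⨆ i, U i = ⊤) :
    Function.Surjective (cechMapH1 f S.g U) :=
  -- `X` is separated (proper over the affine base), so the `U_i ∩ U_j` are affine
  haveI : X.IsSeparated := ⟨by rw [← terminal.comp_from f]; infer_instance⟩
  cechMapH1_surjective_of_shortExact f U hS h₁ hU (fun i j => (hU i).inf (hU j))
    (h A hA X f hbir S.X₁ h₁ ι U hU hcov)

/-- The same for a short exact sequence whose kernel is quasi-coherent in Mathlib's sense. [this work] -/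
theorem GWH2ProperBirationalDim2.cechMapH1_surjective_of_isQuasicoherent (h : GWH2ProperBirationalDim2)
    {A : Type} [CommRing A] {X : Scheme.{0}} (f : X ⟶ Spec (.of A)) {ι : Type} (U : ι → X.Opens)
    [IsNoetherianRing A] [IsLocalRing A] [IsDomain A] (hA : ringKrullDim A ≤ 2) [IsIntegral X] [IsProper f]
    (hbir : IsBirational f) {S : ShortComplex X.Modules} (hS : S.ShortExact) [S.X₁.IsQuasicoherent] [Finite ι]
    (hU : ∀ i, IsAffineOpen (U i)) (hcov : ⨆ i, U i = ⊤) :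
    Function.Surjective (cechMapH1 f S.g U) :=
  h.cechMapH1_surjective f U hA hbir hS (IsAffineLocalizing.of_isQuasicoherent S.X₁) hU hcov

/-! ## Re-export (ii): (H2V) for the preimage pieces over a proper birational `B` (leaf L3) -/

/-- **(H2V) for the pieces `ρ⁻¹W_a`** (modulo the instance): for `g : B → Spec A` proper birational, `B` integral, `A` a Noetherian
local domain of dimension `≤ 2`, `ρ : Z → B` with `Z` Noetherian and a finite affine open cover `𝒲` of `B`, every Čech `2`-cocycle of
`𝒪_Z` on `(ρ⁻¹W_a)_a` is a `2`-coboundary (`Č•((ρ⁻¹W_a), 𝒪_Z) = Č•(𝒲, ρ_*𝒪_Z)`, `ρ_*𝒪_Z` affine-localizing, `Ȟ²(𝒲, ρ_*𝒪_Z) = 0`).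
Instance twin of `Morphisms.cechZ2_exact_preimageFamily_of_GW`. [this work] -/
theorem GWH2ProperBirationalDim2.cechZ2_exact_preimageFamily (h : GWH2ProperBirationalDim2)
    {A : Type} [CommRing A] [IsNoetherianRing A] [IsLocalRing A] [IsDomain A] (hA : ringKrullDim A ≤ 2)
    {B Z : Scheme.{0}} [IsIntegral B] (g : B ⟶ Spec (.of A)) [IsProper g] (hbir : IsBirational g)
    (ρ : Z ⟶ B) [NoetherianSpace Z] (f : Z ⟶ Spec (.of A)) (hf : ρ ≫ g = f)
    {α : Type} [Finite α] (W : α → B.Opens) (hW : ∀ a, IsAffineOpen (W a)) (hcov : ⨆ a, W a = ⊤) :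
    ∀ e : CechC2 f (preimageFamily ρ W), cechD2 f (preimageFamily ρ W) e = 0 →
      ∃ c : CechC1 f (preimageFamily ρ W), cechD1 f (preimageFamily ρ W) c = e :=
  cechZ2_exact_preimageFamily_of_subsingleton_cechMH2_pushforward g W f ρ hf
    (h A hA B g hbir _ (isAffineLocalizing_pushforward ρ IsAffineLocalizing.unit) α W hW hcov)

/-! ## Re-export (iii): the (S)-step along `ρ : Z → B` (leaf L3) -/

/-- **The (S)-step surjection** (modulo the instance): with `g, ρ, f, 𝒲` as in
`GWH2ProperBirationalDim2.cechZ2_exact_preimageFamily`, `𝒰` an open cover of `Z` refining `(ρ⁻¹W_a)_a` and `a₀` an index with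
`Ȟ¹((U_i ∩ ρ⁻¹W_{a₀} ∩ ρ⁻¹W_b)_i, 𝒪_Z) = 0` for `b ≠ a₀`, the map `Ȟ¹(𝒰, 𝒪_Z) → Ȟ¹((U_i ∩ ρ⁻¹W_{a₀})_i, 𝒪_Z)` is surjective.
Instance twin of `Morphisms.cechRefineH1_preimage_piece_surjective_of_GW`. [this work] -/
theorem GWH2ProperBirationalDim2.cechRefineH1_preimage_piece_surjective (h : GWH2ProperBirationalDim2)
    {A : Type} [CommRing A] [IsNoetherianRing A] [IsLocalRing A] [IsDomain A] (hA : ringKrullDim A ≤ 2)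
    {B Z : Scheme.{0}} [IsIntegral B] (g : B ⟶ Spec (.of A)) [IsProper g] (hbir : IsBirational g)
    (ρ : Z ⟶ B) [NoetherianSpace Z] (f : Z ⟶ Spec (.of A)) (hf : ρ ≫ g = f)
    {α : Type} [Finite α] (W : α → B.Opens) (hW : ∀ a, IsAffineOpen (W a)) (hcov : ⨆ a, W a = ⊤)
    {ι : Type} (U : ι → Z.Opens) (r : ι → α) (hr : ∀ i, U i ≤ ρ ⁻¹ᵁ W (r i)) (hU : ⨆ i, U i = ⊤)
    (a₀ : α)
    (hvan : ∀ b, b ≠ a₀ →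
      cechZ1 f (fun i => U i ⊓ ρ ⁻¹ᵁ W a₀ ⊓ ρ ⁻¹ᵁ W b) ≤
        cechB1 f (fun i => U i ⊓ ρ ⁻¹ᵁ W a₀ ⊓ ρ ⁻¹ᵁ W b)) :
    Function.Surjective
      (cechRefineH1 f U (fun i => U i ⊓ ρ ⁻¹ᵁ W a₀) id (fun _ => inf_le_left)) :=
  cechRefineH1_piece_surjective f U (preimageFamily ρ W) r hr hU
    (h.cechZ2_exact_preimageFamily hA g hbir ρ f hf W hW hcov) a₀ hvan

/-- **The (S)-step length inequality** (modulo the instance): under the same hypotheses,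
`length_A Ȟ¹((U_i ∩ ρ⁻¹W_{a₀})_i, 𝒪_Z) ≤ length_A Ȟ¹(𝒰, 𝒪_Z)`.  Instance twin of
`Morphisms.length_cechH1_preimage_piece_le_of_GW`. [this work] -/
theorem GWH2ProperBirationalDim2.length_cechH1_preimage_piece_le (h : GWH2ProperBirationalDim2)
    {A : Type} [CommRing A] [IsNoetherianRing A] [IsLocalRing A] [IsDomain A] (hA : ringKrullDim A ≤ 2)
    {B Z : Scheme.{0}} [IsIntegral B] (g : B ⟶ Spec (.of A)) [IsProper g] (hbir : IsBirational g)
    (ρ : Z ⟶ B) [NoetherianSpace Z] (f : Z ⟶ Spec (.of A)) (hf : ρ ≫ g = f)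
    {α : Type} [Finite α] (W : α → B.Opens) (hW : ∀ a, IsAffineOpen (W a)) (hcov : ⨆ a, W a = ⊤)
    {ι : Type} (U : ι → Z.Opens) (r : ι → α) (hr : ∀ i, U i ≤ ρ ⁻¹ᵁ W (r i)) (hU : ⨆ i, U i = ⊤)
    (a₀ : α)
    (hvan : ∀ b, b ≠ a₀ →
      cechZ1 f (fun i => U i ⊓ ρ ⁻¹ᵁ W a₀ ⊓ ρ ⁻¹ᵁ W b) ≤
        cechB1 f (fun i => U i ⊓ ρ ⁻¹ᵁ W a₀ ⊓ ρ ⁻¹ᵁ W b)) :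
    Module.length A (CechH1 f (fun i => U i ⊓ ρ ⁻¹ᵁ W a₀)) ≤ Module.length A (CechH1 f U) :=
  Module.length_le_of_surjective _
    (h.cechRefineH1_preimage_piece_surjective hA g hbir ρ f hf W hW hcov U r hr hU a₀ hvan)

/-- **The (S)-step with the mixed pieces written as preimages of the affine overlaps `W_{a₀} ∩ W_b`** (modulo the instance):
surjection and length inequality together.  Instance twin of `Morphisms.cechRefineH1_preimage_piece_surjective_of_GW'`. [this work] -/
theorem GWH2ProperBirationalDim2.cechRefineH1_preimage_piece_surjective' (h : GWH2ProperBirationalDim2)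
    {A : Type} [CommRing A] [IsNoetherianRing A] [IsLocalRing A] [IsDomain A] (hA : ringKrullDim A ≤ 2)
    {B Z : Scheme.{0}} [IsIntegral B] (g : B ⟶ Spec (.of A)) [IsProper g] (hbir : IsBirational g)
    (ρ : Z ⟶ B) [NoetherianSpace Z] (f : Z ⟶ Spec (.of A)) (hf : ρ ≫ g = f)
    {α : Type} [Finite α] (W : α → B.Opens) (hW : ∀ a, IsAffineOpen (W a)) (hcov : ⨆ a, W a = ⊤)
    {ι : Type} (U : ι → Z.Opens) (r : ι → α) (hr : ∀ i, U i ≤ ρ ⁻¹ᵁ W (r i)) (hU : ⨆ i, U i = ⊤)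
    (a₀ : α)
    (hvan : ∀ b, b ≠ a₀ →
      cechZ1 f (fun i => U i ⊓ ρ ⁻¹ᵁ (W a₀ ⊓ W b)) ≤ cechB1 f (fun i => U i ⊓ ρ ⁻¹ᵁ (W a₀ ⊓ W b))) :
    Function.Surjective
        (cechRefineH1 f U (fun i => U i ⊓ ρ ⁻¹ᵁ W a₀) id (fun _ => inf_le_left)) ∧
      Module.length A (CechH1 f (fun i => U i ⊓ ρ ⁻¹ᵁ W a₀)) ≤ Module.length A (CechH1 f U) := by
  have hvan' : ∀ b, b ≠ a₀ →
      cechZ1 f (fun i => U i ⊓ ρ ⁻¹ᵁ W a₀ ⊓ ρ ⁻¹ᵁ W b) ≤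
        cechB1 f (fun i => U i ⊓ ρ ⁻¹ᵁ W a₀ ⊓ ρ ⁻¹ᵁ W b) := fun b hb =>
    cechZ1_le_cechB1_of_eq f (funext fun i => inf_assoc (U i) (ρ ⁻¹ᵁ W a₀) (ρ ⁻¹ᵁ W b)) (hvan b hb)
  exact ⟨h.cechRefineH1_preimage_piece_surjective hA g hbir ρ f hf W hW hcov U r hr hU a₀ hvan',
    h.length_cechH1_preimage_piece_le hA g hbir ρ f hf W hW hcov U r hr hU a₀ hvan'⟩

/-! ## §R3b — desk re-cut r2, rider (r2-b) form (text of `GWH2InstanceR2b.lean` 94c5596e024bd2f4, verbatim) -/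

/-- **r2 re-cut (desk, after p613816 = the projective case of GW II Cor. 24.44 is a theorem):** the GW-H2 conclusion for
RESOLUTIONS ONLY of spectra of Noetherian local domains of Krull dimension `= 2` (critic rider R20 (r2-b): every consumer carries `= 2`, and the future discharge is then literally ≤ Lipman (27.2)) — exactly what the W4.4 leaves L1/L2/L4 consume
(L3, the blow-up leaf, is now served by `GortzWedhorn2023_24_44_H2_of_projective` + `affineBlowup.isProjectiveOverRing` with no
hypothesis).  WEAKEN-ONLY chain: `GortzWedhorn2023_24_44_H2 ⇒ GWH2ProperBirationalDim2 ⇒ GWH2ResolutionDim2`; and, on paper,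
Lipman 1969 Cor. (27.2) (p. 277: a resolution of a 2-dim local ring is projective) + p613816 ⇒ `GWH2ResolutionDim2`.
OURS hypothesis Prop; nothing is discharged. [this work] -/
def GWH2ResolutionDim2 : Prop :=
  ∀ (A : Type) [CommRing A] [IsNoetherianRing A] [IsLocalRing A] [IsDomain A], ringKrullDim A = 2 →
    ∀ (X : Scheme.{0}) [IsIntegral X] [IsLocallyNoetherian X] (π : X ⟶ Spec (.of A)), IsResolution π →
      ∀ (M : X.Modules), Literature.AlgebraicGeometry.Modules.IsAffineLocalizing M →
        ∀ (ι : Type) [Finite ι] (U : ι → X.Opens),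
          (∀ i, IsAffineOpen (U i)) → ⨆ i, U i = ⊤ → Subsingleton (CechMH2 π M U)

/-- The proper-birational instance implies the resolution instance (a resolution is proper and birational). [this work] -/
theorem gwH2ResolutionDim2_of_properBirational (h : GWH2ProperBirationalDim2) : GWH2ResolutionDim2 := by
  intro A _ _ _ _ hA X _ _ π hπ M hM ι _ U hU hcov
  haveI : IsProper π := hπ.isProper
  exact h A hA.le X π hπ.isBirational M hM ι U hU hcov

/-- Hence the general named fact implies it. [this work] -/
theorem gwH2ResolutionDim2_of_GW (h : Literature.AlgebraicGeometry.Morphisms.GortzWedhorn2023_24_44_H2.{0}) :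
    GWH2ResolutionDim2 :=
  gwH2ResolutionDim2_of_properBirational (gwH2ProperBirationalDim2_of_GW h)

/-- And the projective GW theorem p613816 reduces it to PROJECTIVITY of resolutions (Lipman (27.2), print, untyped):
stated with the projectivity as an explicit hypothesis. [this work] -/
theorem gwH2ResolutionDim2_of_projectiveResolutions
    (h272 : ∀ (A : Type) [CommRing A] [IsNoetherianRing A] [IsLocalRing A] [IsDomain A], ringKrullDim A = 2 →
      ∀ (X : Scheme.{0}) [IsIntegral X] [IsLocallyNoetherian X] (π : X ⟶ Spec (.of A)), IsResolution π →
        Literature.AlgebraicGeometry.Crystalline.IsProjectiveOverRing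
          (CategoryTheory.Over.mk π : Literature.AlgebraicGeometry.Motives.SchemeOver A)) :
    GWH2ResolutionDim2 := by
  intro A _ _ _ _ hA X _ _ π hπ M hM ι _ U hU hcov
  haveI : IsProper π := hπ.isProper
  exact Literature.AlgebraicGeometry.Morphisms.GortzWedhorn2023_24_44_H2_of_projective A X π (h272 A hA X π hπ)
    (hπ.topologicalKrullDim_fiber_le_one hA.le) M hM ι U hU hcov

/-! ## §R3b re-export (i) at resolutions: right exactness of `Ȟ¹` (leaves L1, L2, L4) -/

/-- **`Ȟ¹` is right exact on a resolution of the spectrum of a Noetherian local domain of dimension `2`** (modulo the instance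
`GWH2ResolutionDim2`): for `π : X → Spec A` a resolution (`X` integral, locally Noetherian), a short exact sequence
`0 → M′ → M → M″ → 0` of `𝒪_X`-modules with `M′` affine-localizing and ANY finite affine open cover `𝒰` of `X`,
`Ȟ¹(𝒰, M) → Ȟ¹(𝒰, M″)` is surjective.  One line over the fact-free core `cechMapH1_surjective_of_shortExact`; the resolution
twin of `GWH2ProperBirationalDim2.cechMapH1_surjective`. [this work] -/
theorem GWH2ResolutionDim2.cechMapH1_surjective (h : GWH2ResolutionDim2)
    {A : Type} [CommRing A] {X : Scheme.{0}} (f : X ⟶ Spec (.of A)) {ι : Type} (U : ι → X.Opens)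
    [IsNoetherianRing A] [IsLocalRing A] [IsDomain A] (hA : ringKrullDim A = 2) [IsIntegral X] [IsLocallyNoetherian X]
    (hπ : IsResolution f) {S : ShortComplex X.Modules} (hS : S.ShortExact)
    (h₁ : IsAffineLocalizing S.X₁) [Finite ι] (hU : ∀ i, IsAffineOpen (U i)) (hcov : ⨆ i, U i = ⊤) :
    Function.Surjective (cechMapH1 f S.g U) :=
  haveI : IsProper f := hπ.isProper
  -- `X` is separated (proper over the affine base), so the `U_i ∩ U_j` are affine
  haveI : X.IsSeparated := ⟨by rw [← terminal.comp_from f]; infer_instance⟩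
  cechMapH1_surjective_of_shortExact f U hS h₁ hU (fun i j => (hU i).inf (hU j))
    (h A hA X f hπ S.X₁ h₁ ι U hU hcov)

/-- The same for a short exact sequence whose kernel is quasi-coherent in Mathlib's sense. [this work] -/
theorem GWH2ResolutionDim2.cechMapH1_surjective_of_isQuasicoherent (h : GWH2ResolutionDim2)
    {A : Type} [CommRing A] {X : Scheme.{0}} (f : X ⟶ Spec (.of A)) {ι : Type} (U : ι → X.Opens)
    [IsNoetherianRing A] [IsLocalRing A] [IsDomain A] (hA : ringKrullDim A = 2) [IsIntegral X] [IsLocallyNoetherian X]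
    (hπ : IsResolution f) {S : ShortComplex X.Modules} (hS : S.ShortExact) [S.X₁.IsQuasicoherent] [Finite ι]
    (hU : ∀ i, IsAffineOpen (U i)) (hcov : ⨆ i, U i = ⊤) :
    Function.Surjective (cechMapH1 f S.g U) :=
  h.cechMapH1_surjective f U hA hπ hS (IsAffineLocalizing.of_isQuasicoherent S.X₁) hU hcov

end Summit.ResolutionOfSingularities.ResolutionOfSingularities.Theorems.NoZeno
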